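/-
Copyright (c) 2026 the pub-hodgecm-mathlib formalisation cell (harness21).  Prover seat hodgecm-mathlib-K2E5-p01 (g4) (free E5 hand, cross-unit), HCML Track B «K2-LIT»,
h413 = `stmt-HodgeConjecture-24833`, line `K2_E3_EllipticInputs`, unit U12, socket #11 road (SC-an), road «FC» ((SC-an) line lead K2E3-p14 (g4) RULINGS #17), brick
(FC-6a) «three K-rational eigenvalues of a near-triangular 3 × 3 matrix with separated diagonal».  2026-09-04.
-/
import Summits.HodgeConjecture.HodgeConjecture.Theorems.K2E3StrongHensel                    -- ★ (FC-H) p857175 (this seat): `exists_isRoot_of_normAbs_eval_lt_sq`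
import Summits.HodgeConjecture.HodgeConjecture.Theorems.K2E3SplitTorusTwistModuleBound       -- ★ (K2E3-p20): `v_le_iff_normAbs_le` (the `Valued.v` ↔ `normAbs` dictionary)
import Literature.NumberTheory.Automorphic.ValuedFieldValuativeRelBridge                      -- ★ `v_le_one_iff_mem_integer`
import Literature.LinearAlgebra.Matrix.CharpolyBlockPatterns                                  -- ★ `charpoly_fin_three_trace_adjugate`
import HarnessLib

/-!
# K2 · E3 · (SC-an) road «FC», brick (FC-6a): THREE `K`-RATIONAL EIGENVALUES OF A NEAR-LOWER-TRIANGULAR `3 × 3` MATRIX WITH SEPARATED DIAGONAL —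
# `χ_g = ∏ (X − λ_i)` with `|λ_i − g_ii| ≤ q^{3M+2k−d}`, by strong Hensel at the diagonal entries

Cell `pub/hodgecm-mathlib`, crux H413 = `stmt-HodgeConjecture-24833` (lane `--supports … --as helper`, count-neutral); (SC-an) line lead K2E3-p14 (g4) (RULINGS #17: head bytes
below; consumer (FC-6b) `K2E3NearSingularOfCompactCentralizer`), dealer K2E3-plan (g3).  THEOREMS ONLY (no `def` ∕ `instance` ∕ `notation` ∕ named fact ∕ `sorry`).  Frame = the
`K`-part of the (SC-an) cand frame: `K` a non-archimedean local field with a compatible `ℤᵐ⁰`-valued `Valued` structure, and the squad's uniformizer letter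
`hϖ : Valued.v ϖ = exp(−1)` (ONE extra binder w.r.t. RULINGS #17, needed for the rescaling `x ↦ ϖ^M x`; every consumer on the line carries it).

THE MATHEMATICS (RULINGS #15 (R15-1)(iv)).  `p := χ_g`; ★ `charpoly_fin_three_trace_adjugate`: `p = X³ − e₁X² + e₂X − e₃` with `e₁ = tr g`, `e₂ = tr adj g`, `e₃ = det g`,
so `p(g_ii) = ` (terms each carrying an upper entry `g₀₁, g₁₂` (`≤ q^{M−d}`) or `g₀₂` (`≤ q^{M−2d}`)) has `|p(g_ii)| ≤ q^{3M−d}`, and `p′(g_ii) = ∏_{j≠i}(g_ii − g_jj) − (g₀₁g₁₀ + g₀₂g₂₀ +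
g₁₂g₂₁)` has `|p′(g_ii)| = |∏_{j≠i}(g_ii − g_jj)| ≥ q^{−2k}` (`d > 2M + 2k`).  Rescale `p̃(y) = ϖ^{3M} p(ϖ^{−M} y) ∈ 𝒪[X]`, `ã_i = ϖ^M g_ii ∈ 𝒪`: `|p̃(ã_i)| ≤ q^{−d} <
q^{−4M−4k} ≤ |p̃′(ã_i)|²` (`d ≥ 4M + 4k + 1`), so ★ (FC-H) STRONG HENSEL gives a root `λ_i` of `p` with `|λ_i − g_ii| · |p′(g_ii)| ≤ |p(g_ii)|`, i.e. `|λ_i − g_ii| ≤ q^{3M+2k−d}`;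
the `λ_i` are pairwise distinct (`d > 3M + 3k`), hence `p = ∏ (X − λ_i)` (a monic cubic minus a monic cubic with three common roots vanishes).
* §1 `exists_isRoot_of_v_eval_lt_sq` — ★ (FC-H) in `Valued.v` currency for `f ∈ K[X]` with integral coefficients;  `exists_v_eq_exp` (`|ϖ^{−M}| = q^M`).
* §2 `eval_charpoly_fin_three`, `eval_derivative_charpoly_fin_three` (the explicit cubic and its derivative), `v_eval_charpoly_le`, `v_eval_derivative_charpoly_eq`.
* §3 **`exists_eigenvalues_near_diagonal`** — the head.

HONEST LABEL: HC_CM is proved only modulo the 7 printed citations (2 remaining named inputs: hLiu418 = `stmt-HodgeConjecture-24832`, h413 = `stmt-HodgeConjecture-24833`)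
until rung 0 closes; count-neutral helper ((FC-6a) of road «FC»; (SC-an) is NOT ★).

## References
* [NeukirchANT1999] J. Neukirch, *Algebraic Number Theory* (1999), Ch. II §4 Lemma (4.6) (Hensel's lemma, strong form).
* [HarishChandra1970] Harish-Chandra (notes by G. van Dijk), *Harmonic Analysis on Reductive p-adic Groups*, LNM 162 (1970), Part VI §8 (the compact-Cartan analysis this serves).
-/

set_option autoImplicit false
-- the mandated namespace has the single-problem summit's repeated segment (`HodgeConjecture.HodgeConjecture`)
set_option linter.dupNamespace false

noncomputable section

open Polynomial Matrix
open scoped WithZero ValuativeRel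
open Literature.NumberTheory.Automorphic
open Literature.NumberTheory.GaloisRepresentations Literature.NumberTheory.GaloisRepresentations.IsNonarchimedeanLocalField
open Summit.HodgeConjecture.HodgeConjecture.Cruxes.H413.K2E3StrongHensel
open Summit.HodgeConjecture.HodgeConjecture.Cruxes.H413.K2E3SplitTorusTwistModuleBound

namespace Summit.HodgeConjecture.HodgeConjecture.Cruxes.H413.K2E3NearTriangularEigenvalues

variable {K : Type*} [Field K] [Valued K ℤᵐ⁰] [ValuativeRel K] [(Valued.v : Valuation K ℤᵐ⁰).Compatible] [IsNonarchimedeanLocalField K]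

/-! ## §1 Strong Hensel in `Valued.v` currency, and the rescaling unit -/

/-- `v x < v y ↔ |x| < |y|` (from ★ `v_le_iff_normAbs_le`). [cite: NeukirchANT1999, Ch. II §4] -/
theorem v_lt_iff_normAbs_lt (x y : K) : Valued.v x < Valued.v y ↔ normAbs K x < normAbs K y := by
  rw [lt_iff_not_ge, lt_iff_not_ge, v_le_iff_normAbs_le]

/-- **STRONG HENSEL, `Valued.v` CURRENCY**: `f ∈ K[X]` with INTEGRAL coefficients (any degree), `a₀` integral, `v(f(a₀)) < v(f′(a₀))²` ⟹ a root `a ∈ K` with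
`v(a − a₀) · v(f′(a₀)) ≤ v(f(a₀))` — ★ (FC-H) `exists_isRoot_of_normAbs_eval_lt_sq` on the lift of `f` to `𝒪[K][X]` (Mathlib `Polynomial.toSubring`).
[cite: NeukirchANT1999, Ch. II §4 Lemma (4.6)] -/
theorem exists_isRoot_of_v_eval_lt_sq (f : K[X]) (hf : ∀ n, Valued.v (f.coeff n) ≤ 1) (a₀ : K) (ha₀ : Valued.v a₀ ≤ 1)
    (hlt : Valued.v (f.eval a₀) < Valued.v (f.derivative.eval a₀) ^ 2) :
    ∃ a : K, f.IsRoot a ∧ Valued.v (a - a₀) * Valued.v (f.derivative.eval a₀) ≤ Valued.v (f.eval a₀) := by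
  classical
  -- lift `f` and `a₀` to `𝒪[K]`
  have hcoeffs : (↑f.coeffs : Set K) ⊆ (𝒪[K] : Set K) := by
    intro c hc
    obtain ⟨n, -, rfl⟩ := mem_coeffs_iff.1 (Finset.mem_coe.1 hc)
    exact (v_le_one_iff_mem_integer _).1 (hf n)
  set f₀ : 𝒪[K][X] := f.toSubring 𝒪[K] hcoeffs with hf₀
  have hmap : f₀.map (𝒪[K]).subtype = f := map_toSubring f 𝒪[K] hcoeffs
  set b₀ : 𝒪[K] := ⟨a₀, (v_le_one_iff_mem_integer _).1 ha₀⟩ with hb₀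
  have hev : ((f₀.eval b₀ : 𝒪[K]) : K) = f.eval a₀ := by
    conv_rhs => rw [← hmap, eval_map, show a₀ = (𝒪[K]).subtype b₀ from rfl, eval₂_at_apply]
    rfl
  have hev' : ((f₀.derivative.eval b₀ : 𝒪[K]) : K) = f.derivative.eval a₀ := by
    conv_rhs => rw [← hmap, derivative_map, eval_map, show a₀ = (𝒪[K]).subtype b₀ from rfl, eval₂_at_apply]
    rfl
  have hlt' : normAbs K ((f₀.eval b₀ : 𝒪[K]) : K) < normAbs K ((f₀.derivative.eval b₀ : 𝒪[K]) : K) ^ 2 := by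
    rw [hev, hev', ← map_pow, ← v_lt_iff_normAbs_lt, map_pow]
    exact hlt
  obtain ⟨a, haroot, hbound⟩ := exists_isRoot_of_normAbs_eval_lt_sq f₀ b₀ hlt'
  refine ⟨(a : K), ?_, ?_⟩
  · -- `f(a) = ↑(f₀(a)) = 0`
    have : f.eval (a : K) = ((f₀.eval a : 𝒪[K]) : K) := by
      conv_lhs => rw [← hmap, eval_map, show (a : K) = (𝒪[K]).subtype a from rfl, eval₂_at_apply]
      rfl
    rw [IsRoot.def, this, haroot.eq_zero]; rfl
  · rw [hev, hev'] at hbound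
    rw [← map_mul, v_le_iff_normAbs_le, map_mul]
    exact hbound

omit [ValuativeRel K] [(Valued.v : Valuation K ℤᵐ⁰).Compatible] [IsNonarchimedeanLocalField K] in
/-- `v(ϖ^{-n}·)`: the rescaling unit `c := (ϖ^n)⁻¹` has `v c = exp n`, and `ϖ^n ≠ 0`. [cite: NeukirchANT1999, Ch. II §4] -/
theorem v_inv_pow_uniformizer {ϖ : K} (hϖ : Valued.v ϖ = WithZero.exp (-1 : ℤ)) (n : ℕ) :
    Valued.v ((ϖ ^ n)⁻¹) = WithZero.exp (n : ℤ) ∧ ϖ ^ n ≠ 0 := by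
  have hϖ0 : ϖ ≠ 0 := by
    intro h; rw [h, map_zero] at hϖ; exact WithZero.coe_ne_zero hϖ.symm
  refine ⟨?_, pow_ne_zero n hϖ0⟩
  rw [map_inv₀, map_pow, hϖ, ← WithZero.exp_nsmul, ← WithZero.exp_neg]
  congr 1; simp

/-! ## §2 The explicit cubic `χ_g` and its derivative at a point -/

omit [Valued K ℤᵐ⁰] [ValuativeRel K] [(Valued.v : Valuation K ℤᵐ⁰).Compatible] [IsNonarchimedeanLocalField K] in
/-- `χ_g(x) = (x − g₀₀)(x − g₁₁)(x − g₂₂) − g₁₂g₂₁(x − g₀₀) − g₀₂g₂₀(x − g₁₁) − g₀₁g₁₀(x − g₂₂) − g₀₁g₁₂g₂₀ − g₀₂g₁₀g₂₁` (★ `charpoly_fin_three_trace_adjugate`, Mathlib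
`adjugate_fin_three`, `det_fin_three`). [cite: HarishChandra1970, Part VI §8] -/
theorem eval_charpoly_fin_three (g : Matrix (Fin 3) (Fin 3) K) (x : K) :
    g.charpoly.eval x = (x - g 0 0) * (x - g 1 1) * (x - g 2 2) - g 1 2 * g 2 1 * (x - g 0 0) - g 0 2 * g 2 0 * (x - g 1 1) - g 0 1 * g 1 0 * (x - g 2 2)
      - g 0 1 * g 1 2 * g 2 0 - g 0 2 * g 1 0 * g 2 1 := by
  rw [Literature.LinearAlgebra.Matrix.CharpolyBlockPatterns.charpoly_fin_three_trace_adjugate, trace_fin_three, adjugate_fin_three, trace_fin_three, det_fin_three]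
  simp only [eval_sub, eval_add, eval_mul, eval_pow, eval_C, eval_X, of_apply, cons_val', cons_val_zero, cons_val_one, cons_val_two, empty_val',
    cons_val_fin_one, head_cons, tail_cons, head_fin_const]
  ring

omit [Valued K ℤᵐ⁰] [ValuativeRel K] [(Valued.v : Valuation K ℤᵐ⁰).Compatible] [IsNonarchimedeanLocalField K] in
/-- `χ_g′(x) = (x − g₁₁)(x − g₂₂) + (x − g₀₀)(x − g₂₂) + (x − g₀₀)(x − g₁₁) − (g₀₁g₁₀ + g₀₂g₂₀ + g₁₂g₂₁)`. [cite: HarishChandra1970, Part VI §8] -/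
theorem eval_derivative_charpoly_fin_three (g : Matrix (Fin 3) (Fin 3) K) (x : K) :
    g.charpoly.derivative.eval x = (x - g 1 1) * (x - g 2 2) + (x - g 0 0) * (x - g 2 2) + (x - g 0 0) * (x - g 1 1)
      - (g 0 1 * g 1 0 + g 0 2 * g 2 0 + g 1 2 * g 2 1) := by
  rw [Literature.LinearAlgebra.Matrix.CharpolyBlockPatterns.charpoly_fin_three_trace_adjugate, trace_fin_three, adjugate_fin_three, trace_fin_three]
  simp only [derivative_sub, derivative_add, derivative_mul, derivative_X_pow, derivative_C, derivative_X, eval_sub, eval_add, eval_mul, eval_pow, eval_C, eval_X,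
    of_apply, cons_val', cons_val_zero, cons_val_one, cons_val_two, empty_val', cons_val_fin_one, head_cons, tail_cons, head_fin_const, zero_mul, mul_one,
    zero_add, sub_zero]
  push_cast
  ring

/-! ## §3 The head -/

set_option maxHeartbeats 800000 in
-- one long proof with many valuation estimates; the extra budget is for the `Fin 3` case splits
/-- **(FC-6a) «THREE `K`-RATIONAL EIGENVALUES OF A NEAR-LOWER-TRIANGULAR `3 × 3` WITH SEPARATED DIAGONAL»** (RULINGS #17, head bytes + the uniformizer letter `hϖ`).
Entries `≤ q^M`, upper entries `g₀₁, g₁₂ ≤ q^{M−d}`, `g₀₂ ≤ q^{M−2d}`, diagonal entries pairwise `q^{−k}`-separated, `d ≥ 4M + 4k + 1` ⟹ `χ_g = ∏_i (X − λ_i)` with `λ_i ∈ K` and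
`|λ_i − g_ii| ≤ q^{3M+2k−d}` (so the `λ_i` are pairwise distinct and `λ_i` is the unique eigenvalue `q^{−k}`-near `g_ii`).  Strong Hensel (★ (FC-H)) at `ϖ^M g_ii` for the rescaled
cubic `ϖ^{3M} χ_g(ϖ^{−M} y)`. [cite: NeukirchANT1999, Ch. II §4 Lemma (4.6)] [cite: HarishChandra1970, Part VI §8 p. 60] -/
theorem exists_eigenvalues_near_diagonal {ϖ : K} (hϖ : Valued.v ϖ = WithZero.exp (-1 : ℤ))
    (g : Matrix (Fin 3) (Fin 3) K) (M k d : ℕ) (hd : 4 * M + 4 * k + 1 ≤ d)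
    (hall : ∀ i j, Valued.v (g i j) ≤ WithZero.exp (M : ℤ))
    (h01 : Valued.v (g 0 1) ≤ WithZero.exp ((M : ℤ) - d)) (h12 : Valued.v (g 1 2) ≤ WithZero.exp ((M : ℤ) - d))
    (h02 : Valued.v (g 0 2) ≤ WithZero.exp ((M : ℤ) - 2 * d))
    (hsep : ∀ i j : Fin 3, i ≠ j → WithZero.exp (-(k : ℤ)) ≤ Valued.v (g i i - g j j)) :
    ∃ lam : Fin 3 → K, g.charpoly = ∏ i, (Polynomial.X - Polynomial.C (lam i)) ∧
      ∀ i, Valued.v (lam i - g i i) ≤ WithZero.exp (3 * (M : ℤ) + 2 * k - d) := by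
  classical
  set v : Valuation K ℤᵐ⁰ := Valued.v with hvdef
  set p := g.charpoly with hp
  -- (0) bookkeeping on exponents
  have hMd : ∀ {x : K} {e : ℤ}, v x ≤ WithZero.exp e → ∀ {e' : ℤ}, e ≤ e' → v x ≤ WithZero.exp e' :=
    fun h _ hee => h.trans (WithZero.exp_le_exp.2 hee)
  have h01' : v (g 0 1) ≤ WithZero.exp ((M : ℤ) - d) := h01
  have h12' : v (g 1 2) ≤ WithZero.exp ((M : ℤ) - d) := h12
  have h02' : v (g 0 2) ≤ WithZero.exp ((M : ℤ) - d) := hMd h02 (by omega)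
  have hdiff : ∀ i j, v (g i i - g j j) ≤ WithZero.exp (M : ℤ) := fun i j => v.map_sub_le (hall i i) (hall j j)
  have hxsub : ∀ i j x, v (x - g i i) ≤ WithZero.exp (3 * (M : ℤ) + 2 * k - d) → v (x - g j j) ≤ WithZero.exp (M : ℤ) := by
    intro i j x hx
    have : x - g j j = (x - g i i) + (g i i - g j j) := by ring
    rw [this]
    exact v.map_add_le (hMd hx (by omega)) (hdiff i j)
  -- (1) `|p(g_ii)| ≤ q^{3M-d}` and `|p'(g_ii)| = |∏_{j≠i}(g_ii - g_jj)| ≥ q^{-2k}`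
  have hmul3 : ∀ {x y z : K} {a b c : ℤ}, v x ≤ WithZero.exp a → v y ≤ WithZero.exp b → v z ≤ WithZero.exp c →
      v (x * y * z) ≤ WithZero.exp (a + b + c) := by
    intro x y z a b c hx hy hz
    rw [map_mul, map_mul, WithZero.exp_add, WithZero.exp_add]
    exact mul_le_mul' (mul_le_mul' hx hy) hz
  have hpval : ∀ i, v (p.eval (g i i)) ≤ WithZero.exp (3 * (M : ℤ) - d) := by
    have hM : ∀ a b : Fin 3, v (g a a - g b b) ≤ WithZero.exp (M : ℤ) := fun a b => hdiff a b
    have hE0 : p.eval (g 0 0) = -(g 0 2 * g 2 0 * (g 0 0 - g 1 1)) - g 0 1 * g 1 0 * (g 0 0 - g 2 2) - g 0 1 * g 1 2 * g 2 0 - g 0 2 * g 1 0 * g 2 1 := by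
      rw [hp, eval_charpoly_fin_three]; ring
    have hE1 : p.eval (g 1 1) = -(g 1 2 * g 2 1 * (g 1 1 - g 0 0)) - g 0 1 * g 1 0 * (g 1 1 - g 2 2) - g 0 1 * g 1 2 * g 2 0 - g 0 2 * g 1 0 * g 2 1 := by
      rw [hp, eval_charpoly_fin_three]; ring
    have hE2 : p.eval (g 2 2) = -(g 1 2 * g 2 1 * (g 2 2 - g 0 0)) - g 0 2 * g 2 0 * (g 2 2 - g 1 1) - g 0 1 * g 1 2 * g 2 0 - g 0 2 * g 1 0 * g 2 1 := by
      rw [hp, eval_charpoly_fin_three]; ring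
    have hcub1 : v (g 0 1 * g 1 2 * g 2 0) ≤ WithZero.exp (3 * (M : ℤ) - d) := hMd (hmul3 h01' h12' (hall 2 0)) (by omega)
    have hcub2 : v (g 0 2 * g 1 0 * g 2 1) ≤ WithZero.exp (3 * (M : ℤ) - d) := hMd (hmul3 h02' (hall 1 0) (hall 2 1)) (by omega)
    intro i
    fin_cases i
    · show v (p.eval (g 0 0)) ≤ _
      rw [hE0]
      refine v.map_sub_le (v.map_sub_le (v.map_sub_le ?_ ?_) hcub1) hcub2
      · rw [Valuation.map_neg]; exact hMd (hmul3 h02' (hall 2 0) (hM 0 1)) (by omega)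
      · exact hMd (hmul3 h01' (hall 1 0) (hM 0 2)) (by omega)
    · show v (p.eval (g 1 1)) ≤ _
      rw [hE1]
      refine v.map_sub_le (v.map_sub_le (v.map_sub_le ?_ ?_) hcub1) hcub2
      · rw [Valuation.map_neg]; exact hMd (hmul3 h12' (hall 2 1) (hM 1 0)) (by omega)
      · exact hMd (hmul3 h01' (hall 1 0) (hM 1 2)) (by omega)
    · show v (p.eval (g 2 2)) ≤ _
      rw [hE2]
      refine v.map_sub_le (v.map_sub_le (v.map_sub_le ?_ ?_) hcub1) hcub2
      · rw [Valuation.map_neg]; exact hMd (hmul3 h12' (hall 2 1) (hM 2 0)) (by omega)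
      · exact hMd (hmul3 h02' (hall 2 0) (hM 2 1)) (by omega)
  -- the correction term of the derivative
  have hS : v (g 0 1 * g 1 0 + g 0 2 * g 2 0 + g 1 2 * g 2 1) ≤ WithZero.exp (2 * (M : ℤ) - d) := by
    have h2 : ∀ {x y : K} {a b : ℤ}, v x ≤ WithZero.exp a → v y ≤ WithZero.exp b → v (x * y) ≤ WithZero.exp (a + b) := by
      intro x y a b hx hy; rw [map_mul, WithZero.exp_add]; exact mul_le_mul' hx hy
    refine v.map_add_le (v.map_add_le ?_ ?_) ?_
    · exact hMd (h2 h01' (hall 1 0)) (by omega)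
    · exact hMd (h2 h02' (hall 2 0)) (by omega)
    · exact hMd (h2 h12' (hall 2 1)) (by omega)
  -- the main product `P_i = ∏_{j ≠ i} (g_ii - g_jj)` at each `i`, and `p'(g_ii) = P_i - S`
  have hderiv : ∀ i, ∃ P : K, p.derivative.eval (g i i) = P - (g 0 1 * g 1 0 + g 0 2 * g 2 0 + g 1 2 * g 2 1) ∧
      WithZero.exp (-(2 * (k : ℤ))) ≤ v P ∧ v P ≤ WithZero.exp (2 * (M : ℤ)) := by
    have hPP : ∀ a b : Fin 3, a ≠ b → ∀ c : Fin 3, a ≠ c →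
        WithZero.exp (-(2 * (k : ℤ))) ≤ v ((g a a - g b b) * (g a a - g c c)) ∧ v ((g a a - g b b) * (g a a - g c c)) ≤ WithZero.exp (2 * (M : ℤ)) := by
      intro a b hab c hac
      rw [map_mul, show (-(2 * (k : ℤ))) = -(k : ℤ) + -(k : ℤ) by ring, show (2 * (M : ℤ)) = (M : ℤ) + (M : ℤ) by ring, WithZero.exp_add, WithZero.exp_add]
      exact ⟨mul_le_mul' (hsep a b hab) (hsep a c hac), mul_le_mul' (hdiff a b) (hdiff a c)⟩
    intro i
    rw [hp, eval_derivative_charpoly_fin_three]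
    fin_cases i
    · refine ⟨(g 0 0 - g 1 1) * (g 0 0 - g 2 2), by simp, hPP 0 1 (by decide) 2 (by decide)⟩
    · refine ⟨(g 1 1 - g 0 0) * (g 1 1 - g 2 2), by simp, hPP 1 0 (by decide) 2 (by decide)⟩
    · refine ⟨(g 2 2 - g 0 0) * (g 2 2 - g 1 1), by simp, hPP 2 0 (by decide) 1 (by decide)⟩
  have hdval : ∀ i, WithZero.exp (-(2 * (k : ℤ))) ≤ v (p.derivative.eval (g i i)) ∧ v (p.derivative.eval (g i i)) ≤ WithZero.exp (2 * (M : ℤ)) := by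
    intro i
    obtain ⟨P, hP, hPlo, hPhi⟩ := hderiv i
    have hSlt : v (g 0 1 * g 1 0 + g 0 2 * g 2 0 + g 1 2 * g 2 1) < v P :=
      lt_of_le_of_lt hS (lt_of_lt_of_le (WithZero.exp_lt_exp.2 (by omega)) hPlo)
    have heq : v (p.derivative.eval (g i i)) = v P := by
      rw [hP, sub_eq_add_neg]
      exact v.map_add_eq_of_lt_left (by rwa [Valuation.map_neg])
    rw [heq]; exact ⟨hPlo, hPhi⟩
  -- (2) the rescaled cubic `pt(y) = c⁻³ p(c y)`, `c = ϖ^{-M}`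
  obtain ⟨hvc, hϖM⟩ := v_inv_pow_uniformizer hϖ M
  set c : K := (ϖ ^ M)⁻¹ with hc
  have hc0 : c ≠ 0 := inv_ne_zero hϖM
  have hvc' : v c = WithZero.exp (M : ℤ) := hvc
  set e₁ : K := g.trace with he₁
  set e₂ : K := g.adjugate.trace with he₂
  set e₃ : K := g.det with he₃
  have hpform : p = X ^ 3 - C e₁ * X ^ 2 + C e₂ * X - C e₃ := by
    rw [hp, Literature.LinearAlgebra.Matrix.CharpolyBlockPatterns.charpoly_fin_three_trace_adjugate]
  set pt : K[X] := X ^ 3 + C (-(e₁ / c)) * X ^ 2 + C (e₂ / c ^ 2) * X + C (-(e₃ / c ^ 3)) with hpt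
  have hpt_eval : ∀ y, pt.eval y = c⁻¹ ^ 3 * p.eval (c * y) := by
    intro y
    rw [hpform]
    simp only [hpt, eval_add, eval_sub, eval_mul, eval_pow, eval_C, eval_X]
    field_simp
    ring
  have hpt_deriv : ∀ y, pt.derivative.eval y = c⁻¹ ^ 2 * p.derivative.eval (c * y) := by
    intro y
    rw [hpform]
    simp only [hpt, derivative_add, derivative_sub, derivative_mul, derivative_X_pow, derivative_C, derivative_X, eval_add, eval_sub, eval_mul, eval_pow, eval_C, eval_X,
      zero_mul, mul_one, zero_add, add_zero, sub_zero]
    push_cast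
    field_simp
    ring
  -- the symmetric functions are bounded: `|e_j| ≤ q^{jM}`
  have he₁v : v e₁ ≤ WithZero.exp (M : ℤ) := by
    rw [he₁, trace_fin_three]; exact v.map_add_le (v.map_add_le (hall 0 0) (hall 1 1)) (hall 2 2)
  have h2M : ∀ {x y : K}, v x ≤ WithZero.exp (M : ℤ) → v y ≤ WithZero.exp (M : ℤ) → v (x * y) ≤ WithZero.exp (2 * (M : ℤ)) := by
    intro x y hx hy; rw [map_mul, two_mul, WithZero.exp_add]; exact mul_le_mul' hx hy
  have he₂v : v e₂ ≤ WithZero.exp (2 * (M : ℤ)) := by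
    rw [he₂, adjugate_fin_three, trace_fin_three]
    simp only [of_apply, cons_val', cons_val_zero, cons_val_one, cons_val_two, empty_val', cons_val_fin_one]
    refine v.map_add_le (v.map_add_le (v.map_sub_le (h2M (hall 1 1) (hall 2 2)) (h2M (hall 1 2) (hall 2 1)))
      (v.map_sub_le (h2M (hall 0 0) (hall 2 2)) (h2M (hall 0 2) (hall 2 0)))) (v.map_sub_le (h2M (hall 0 0) (hall 1 1)) (h2M (hall 0 1) (hall 1 0)))
  have he₃v : v e₃ ≤ WithZero.exp (3 * (M : ℤ)) := by
    rw [he₃, det_fin_three]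
    have h3 : ∀ a b c' : Fin 3 × Fin 3, v (g a.1 a.2 * g b.1 b.2 * g c'.1 c'.2) ≤ WithZero.exp (3 * (M : ℤ)) := by
      intro a b c'
      rw [show (3 * (M : ℤ)) = (M : ℤ) + M + M by ring]
      exact hmul3 (hall _ _) (hall _ _) (hall _ _)
    refine v.map_sub_le (v.map_add_le (v.map_add_le (v.map_sub_le (v.map_sub_le (h3 (0,0) (1,1) (2,2)) (h3 (0,0) (1,2) (2,1))) (h3 (0,1) (1,0) (2,2)))
      (h3 (0,1) (1,2) (2,0))) (h3 (0,2) (1,0) (2,1))) (h3 (0,2) (1,1) (2,0))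
  -- the coefficients of `pt` are integral
  have hcinv : ∀ n : ℕ, v (c ^ n)⁻¹ = WithZero.exp (-((n : ℤ) * M)) := by
    intro n
    rw [map_inv₀, map_pow, hvc', ← WithZero.exp_nsmul, ← WithZero.exp_neg]
    congr 1
  have hdivle : ∀ {x : K} {n : ℕ}, v x ≤ WithZero.exp ((n : ℤ) * M) → v (x / c ^ n) ≤ 1 := by
    intro x n hx
    rw [div_eq_mul_inv, map_mul, hcinv, ← WithZero.exp_zero]
    calc v x * WithZero.exp (-((n : ℤ) * M)) ≤ WithZero.exp ((n : ℤ) * M) * WithZero.exp (-((n : ℤ) * M)) := mul_le_mul' hx le_rfl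
      _ = WithZero.exp 0 := by rw [← WithZero.exp_add]; congr 1; ring
  have hdivle1 : ∀ {x : K}, v x ≤ WithZero.exp (M : ℤ) → v (x / c) ≤ 1 := by
    intro x hx
    have h := hdivle (x := x) (n := 1) (by simpa using hx)
    rwa [pow_one] at h
  have hptcoeff : ∀ n, v (pt.coeff n) ≤ 1 := by
    have hc1 : v (-(e₁ / c)) ≤ 1 := by rw [Valuation.map_neg]; exact hdivle1 he₁v
    have hc2 : v (e₂ / c ^ 2) ≤ 1 := hdivle (n := 2) (by simpa using he₂v)
    have hc3 : v (-(e₃ / c ^ 3)) ≤ 1 := by rw [Valuation.map_neg]; exact hdivle (n := 3) (by simpa using he₃v)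
    have hk0 : pt.coeff 0 = -(e₃ / c ^ 3) := by simp [hpt]
    have hk1 : pt.coeff 1 = e₂ / c ^ 2 := by simp [hpt]
    have hk2 : pt.coeff 2 = -(e₁ / c) := by simp [hpt]
    have hk3 : pt.coeff 3 = 1 := by simp [hpt]
    have hk4 : ∀ n, pt.coeff (n + 4) = 0 := by intro n; simp [hpt]
    intro n
    rcases n with _ | _ | _ | _ | n
    · rw [hk0]; exact hc3
    · rw [hk1]; exact hc2
    · rw [hk2]; exact hc1
    · rw [hk3, map_one]
    · rw [hk4, map_zero]; exact bot_le
  -- (3) strong Hensel at `ã_i = g_ii / c`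
  have hroot : ∀ i, ∃ l : K, p.IsRoot l ∧ v (l - g i i) ≤ WithZero.exp (3 * (M : ℤ) + 2 * k - d) := by
    intro i
    have hai : v (g i i / c) ≤ 1 := hdivle1 (hall i i)
    obtain ⟨hdlo, -⟩ := hdval i
    -- `v(pt(ã)) ≤ q^{-d}`, `v(pt'(ã)) ≥ q^{-2M-2k}`
    have hcy : c * (g i i / c) = g i i := by field_simp
    have hev : v (pt.eval (g i i / c)) ≤ WithZero.exp (-(d : ℤ)) := by
      rw [hpt_eval, hcy, map_mul, map_pow, show c⁻¹ = (c ^ 1)⁻¹ by rw [pow_one], hcinv]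
      calc WithZero.exp (-((1 : ℕ) * (M : ℤ))) ^ 3 * v (p.eval (g i i))
          ≤ WithZero.exp (-((1 : ℕ) * (M : ℤ))) ^ 3 * WithZero.exp (3 * (M : ℤ) - d) := mul_le_mul' le_rfl (hpval i)
        _ = WithZero.exp (-(d : ℤ)) := by rw [← WithZero.exp_nsmul, ← WithZero.exp_add]; congr 1; simp; ring
    have hed : WithZero.exp (-(2 * (M : ℤ)) - 2 * k) ≤ v (pt.derivative.eval (g i i / c)) := by
      rw [hpt_deriv, hcy, map_mul, map_pow, show c⁻¹ = (c ^ 1)⁻¹ by rw [pow_one], hcinv]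
      calc WithZero.exp (-(2 * (M : ℤ)) - 2 * k) = WithZero.exp (-((1 : ℕ) * (M : ℤ))) ^ 2 * WithZero.exp (-(2 * (k : ℤ))) := by
            rw [← WithZero.exp_nsmul, ← WithZero.exp_add]; congr 1; simp; ring
        _ ≤ WithZero.exp (-((1 : ℕ) * (M : ℤ))) ^ 2 * v (p.derivative.eval (g i i)) := mul_le_mul' le_rfl hdlo
    have hlt : v (pt.eval (g i i / c)) < v (pt.derivative.eval (g i i / c)) ^ 2 := by
      refine lt_of_le_of_lt hev (lt_of_lt_of_le ?_ (pow_le_pow_left' hed 2))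
      rw [← WithZero.exp_nsmul, WithZero.exp_lt_exp]; simp; omega
    obtain ⟨t, htroot, htb⟩ := exists_isRoot_of_v_eval_lt_sq pt hptcoeff (g i i / c) hai hlt
    refine ⟨c * t, ?_, ?_⟩
    · -- `p(c t) = c³ pt(t) = 0`
      have := hpt_eval t
      rw [htroot.eq_zero] at this
      rw [IsRoot.def]
      have hc3 : c⁻¹ ^ 3 ≠ 0 := pow_ne_zero 3 (inv_ne_zero hc0)
      exact (mul_eq_zero.1 this.symm).resolve_left hc3
    · -- `v(c t - g_ii) = v(c) v(t - ã) ≤ v(c) v(pt(ã)) / v(pt'(ã)) ≤ q^{3M+2k-d}`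
      have hne : v (pt.derivative.eval (g i i / c)) ≠ 0 := ne_of_gt (lt_of_lt_of_le WithZero.exp_pos hed)
      have ht1 : v (t - g i i / c) ≤ v (pt.eval (g i i / c)) * (v (pt.derivative.eval (g i i / c)))⁻¹ := by
        rw [le_mul_inv_iff₀ (pos_iff_ne_zero.2 hne)]; exact htb
      have hct : c * t - g i i = c * (t - g i i / c) := by field_simp
      rw [hct, map_mul, hvc']
      calc WithZero.exp (M : ℤ) * v (t - g i i / c)
          ≤ WithZero.exp (M : ℤ) * (WithZero.exp (-(d : ℤ)) * (WithZero.exp (-(2 * (M : ℤ)) - 2 * k))⁻¹) := by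
            refine mul_le_mul' le_rfl (ht1.trans ?_)
            exact mul_le_mul' hev (inv_anti₀ WithZero.exp_pos hed)
        _ = WithZero.exp (3 * (M : ℤ) + 2 * k - d) := by
            rw [← WithZero.exp_neg, ← WithZero.exp_add, ← WithZero.exp_add]; congr 1; ring
  choose lam hlamroot hlam using hroot
  refine ⟨lam, ?_, hlam⟩
  -- (4) the roots are pairwise distinct, hence `p = ∏ (X - C (lam i))`
  have hinj : Function.Injective lam := by
    intro i j hij
    by_contra hne
    have hsmall : v ((lam i - g i i) - (lam j - g j j)) < WithZero.exp (-(k : ℤ)) :=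
      lt_of_le_of_lt (v.map_sub_le (hlam i) (hlam j)) (WithZero.exp_lt_exp.2 (by omega))
    have hbig : WithZero.exp (-(k : ℤ)) ≤ v (g i i - g j j) := hsep i j hne
    have heq : (lam i - g i i) - (lam j - g j j) = -(g i i - g j j) := by rw [hij]; ring
    rw [heq, Valuation.map_neg] at hsmall
    exact absurd hbig (not_le.2 hsmall)
  have hpmonic : p.Monic := by rw [hp]; exact charpoly_monic g
  have hpdeg : p.natDegree = 3 := by rw [hp, charpoly_natDegree_eq_dim]; simp
  set Q : K[X] := ∏ i, (X - C (lam i)) with hQ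
  have hQmonic : Q.Monic := monic_prod_of_monic _ _ fun i _ => monic_X_sub_C (lam i)
  have hQdeg : Q.natDegree = 3 := by
    rw [hQ, natDegree_prod_of_monic _ _ fun i _ => monic_X_sub_C (lam i)]
    simp
  have hsub : p - Q = 0 := by
    by_cases h0 : p - Q = 0
    · exact h0
    refine eq_zero_of_natDegree_lt_card_of_eval_eq_zero (p - Q) hinj (fun i => ?_) ?_
    · rw [eval_sub, (hlamroot i).eq_zero, hQ, eval_prod, Finset.prod_eq_zero (Finset.mem_univ i) (by simp), sub_zero]
    · have hlt : (p - Q).degree < p.degree :=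
        degree_sub_lt (by rw [degree_eq_natDegree hpmonic.ne_zero, degree_eq_natDegree hQmonic.ne_zero, hpdeg, hQdeg]) hpmonic.ne_zero
          (by rw [hpmonic.leadingCoeff, hQmonic.leadingCoeff])
      have := natDegree_lt_natDegree h0 hlt
      rw [hpdeg] at this
      simpa using this
  exact sub_eq_zero.1 hsub

end Summit.HodgeConjecture.HodgeConjecture.Cruxes.H413.K2E3NearTriangularEigenvalues

end
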